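import Mathlib
import HarnessLib
import Summits.Ventures.LatticeQCDFlow.Scaling.WilsonIdentityFlowLaw2D
import Summits.Ventures.LatticeQCDFlow.Scaling.U1TorusIdentityFlowGeometricLaw
import Literature.Analysis.FunctionSpaces.BesselIIntegralSeries

/-!
# LatticeQCDFlow / Scaling — the untrained SU(2) sampler on the 2-d torus collapses geometrically in
# the volume at the factorised rate: `I₁(x)^V ≤ Σ_{n≥1} I_n(x)^V ≤ I₁(x)^{V−1} eˣ`, hence
# `ESS^{SU(2)}_{L×L} ∈ ((2/β)·I₁(2β)²/I₁(4β))^{L²} · [I₁(4β)e^{−4β}, e^{4β}/I₁(2β)²]`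

HONEST FRAMING: exact (Metropolis-corrected) sampling algorithms for lattice gauge theory;
figures of merit are autocorrelation/cost numbers at stated couplings and volumes; no
continuum-physics claim.

Venture `LatticeQCDFlow` (cell pub-lqcd), topic `Scaling`; FANOUT row 3 (`s0-u1-a`, S0-B
implementation A, GEN-13).  NEW WORK of the cell (closed-form inequalities, no numerics): the SU(2)
companion of row 3's `Scaling/U1TorusIdentityFlowGeometricLaw` (imported for the algebra
`sq_div_mem_Icc`, `geometric_lower_eq`, `geometric_upper_eq`).  Row 3's
`Scaling/WilsonIdentityFlowLaw2D` (imported) gives, for `β > 0` and every `L ≥ 1`, the untrained SU(2)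
sampler's `ESS = (2/β)^{L²} S⁺(2β)²/S⁺(4β)` and `acc ≤ (4/β)^{L²} S⁺(β)²/S⁺(2β)` with the sector sums
`S⁺_V(x) = Σ_{n∈ℕ} I_{n+1}(x)^V` of row 5's exact torus partition function; the tree's Bessel facts
(`besselI_pos`, `besselI_le_besselI_of_le` — `n ↦ I_n(x)` is non-increasing for `x ≥ 0`, Soni 1965 —
and the generating function `Σ_{k∈ℤ} I_{|k|}(x) = eˣ`) sandwich them:

* §1 `summable_besselI_succ`, `tsum_besselI_succ_le_exp` (`Σ_{n≥1} I_n(x) ≤ eˣ`),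
  `summable_besselI_succ_pow_of_pos`, **`besselI_one_pow_le_su2Sum`** / **`su2Sum_le`** —
  `I₁(x)^V ≤ S⁺_V(x) ≤ I₁(x)^{V−1}·eˣ`;
* §2 **`su2TorusIdentityFlow_essFrac_geometric`** — for `β > 0` (`V = L²`, `4β` written `2·(2β)`):
  `r^V · I₁(4β)e^{−4β} ≤ ESS ≤ r^V · e^{4β}/I₁(2β)²` with `r = (2/β)·I₁(2β)²/I₁(4β)` — the per-plaquette
  ESS of the factorised SU(2) model in theory-2's action convention (row 3's
  `SU2IdentityFlowVolumeLaw` has `4I₁(b)²/(b I₁(2b))` at `b = 2β`);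
* §3 **`su2TorusIdentityFlow_meanAccept_geometric`** —
  `(8/9)·r^V·I₁(4β)e^{−4β} ≤ acc ≤ ((4/β)·I₁(β)²/I₁(2β))^V · e^{2β}/I₁(β)²`.

Reading (value-free; no number of ours is computed or implied): as for U(1), the single global
constraint of the SU(2) torus shifts the untrained sampler's ESS and acceptance only by explicit
volume-independent factors; both decay geometrically in `L²` at the factorised rates.  NOT CLAIMED:
that the rates are `< 1` is not re-proved here (it is the imperfection of the one-plaquette flow);
SU(3); `d = 4`; any value at the cell's `(β, L)`; nothing re-scored, SEALED.md untouched.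
-/

noncomputable section

namespace Summit.Ventures.LatticeQCDFlow.Theory2

open MeasureTheory Real
open Literature.Analysis.FunctionSpaces (besselI besselI_nonneg hasSum_besselI_natAbs
  summable_besselI_natAbs besselI_le_besselI_of_le)
open Literature.MathematicalPhysics.QuantumFieldTheory
open Literature.MathematicalPhysics.QuantumLattice (fundamentalRep)
open Summit.Ventures.LatticeQCDFlow.Scoring (besselI_pos)

/-! ## §1 The SU(2) sector-sum sandwich `I₁(x)^V ≤ Σ_{n≥1} I_n(x)^V ≤ I₁(x)^{V−1} eˣ` -/

section SectorSum

variable {x : ℝ} {V : ℕ}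

/-- `n ↦ I_{n+1}(x)` is summable. [folklore] -/
theorem summable_besselI_succ (x : ℝ) : Summable fun n : ℕ => besselI (n + 1) x := by
  have hi : Function.Injective fun n : ℕ => ((n + 1 : ℕ) : ℤ) :=
    fun a b h => by simpa using h
  have h := (summable_besselI_natAbs x).comp_injective hi
  refine h.congr fun n => ?_
  simp only [Function.comp_apply, Int.natAbs_natCast]

/-- `Σ_{n≥1} I_n(x) ≤ Σ_{k∈ℤ} I_{|k|}(x) = eˣ` for `x ≥ 0`. [folklore] -/
theorem tsum_besselI_succ_le_exp (hx : 0 ≤ x) : ∑' n : ℕ, besselI (n + 1) x ≤ Real.exp x := by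
  have hi : Function.Injective fun n : ℕ => ((n + 1 : ℕ) : ℤ) :=
    fun a b h => by simpa using h
  have h := tsum_comp_le_tsum_of_inj (summable_besselI_natAbs x) (fun k => besselI_nonneg _ hx) hi
  rw [(hasSum_besselI_natAbs x).tsum_eq] at h
  refine le_trans (le_of_eq (tsum_congr fun n => ?_)) h
  simp only [Function.comp_apply, Int.natAbs_natCast]

/-- `n ↦ I_{n+1}(x)^V` is summable for `x > 0`, `V ≥ 1` (`I_{n+1}^V ≤ I₁^{V−1} I_{n+1}`). [folklore] -/
theorem summable_besselI_succ_pow_of_pos (hx : 0 < x) (hV : 1 ≤ V) :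
    Summable fun n : ℕ => besselI (n + 1) x ^ V := by
  obtain ⟨W, rfl⟩ := Nat.exists_eq_add_of_le' hV
  refine Summable.of_nonneg_of_le (fun n => pow_nonneg (besselI_pos _ hx).le _) (fun n => ?_)
    ((summable_besselI_succ x).mul_left (besselI 1 x ^ W))
  rw [pow_succ]
  exact mul_le_mul_of_nonneg_right (pow_le_pow_left₀ (besselI_pos _ hx).le
    (besselI_le_besselI_of_le (by omega) hx.le) W) (besselI_pos _ hx).le

/-- The SU(2) sector sum is positive. [folklore] -/
theorem su2Sum_pos (hx : 0 < x) (hV : 1 ≤ V) : 0 < ∑' n : ℕ, besselI (n + 1) x ^ V :=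
  (summable_besselI_succ_pow_of_pos hx hV).tsum_pos (fun _ => pow_nonneg (besselI_pos _ hx).le _) 0
    (pow_pos (besselI_pos _ hx) _)

/-- **Lower SU(2) sector-sum bound**: `I₁(x)^V ≤ Σ_{n∈ℕ} I_{n+1}(x)^V` (the `n = 0` term). [ours] -/
theorem besselI_one_pow_le_su2Sum (hx : 0 < x) (hV : 1 ≤ V) :
    besselI 1 x ^ V ≤ ∑' n : ℕ, besselI (n + 1) x ^ V := by
  have h := (summable_besselI_succ_pow_of_pos hx hV).le_tsum 0
    (fun _ _ => pow_nonneg (besselI_pos _ hx).le _)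
  simpa using h

/-- **Upper SU(2) sector-sum bound**: `Σ_{n∈ℕ} I_{n+1}(x)^V ≤ I₁(x)^{V−1}·eˣ`. [ours] -/
theorem su2Sum_le (hx : 0 < x) (hV : 1 ≤ V) :
    ∑' n : ℕ, besselI (n + 1) x ^ V ≤ besselI 1 x ^ (V - 1) * Real.exp x := by
  obtain ⟨W, rfl⟩ := Nat.exists_eq_add_of_le' hV
  rw [show W + 1 - 1 = W from rfl]
  have hle : ∀ n : ℕ, besselI (n + 1) x ^ (W + 1) ≤ besselI 1 x ^ W * besselI (n + 1) x :=
    fun n => by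
      rw [pow_succ]
      exact mul_le_mul_of_nonneg_right (pow_le_pow_left₀ (besselI_pos _ hx).le
        (besselI_le_besselI_of_le (by omega) hx.le) W) (besselI_pos _ hx).le
  calc ∑' n : ℕ, besselI (n + 1) x ^ (W + 1)
      ≤ ∑' n : ℕ, besselI 1 x ^ W * besselI (n + 1) x :=
        (summable_besselI_succ_pow_of_pos hx hV).tsum_le_tsum hle
          ((summable_besselI_succ x).mul_left _)
    _ = besselI 1 x ^ W * ∑' n : ℕ, besselI (n + 1) x := tsum_mul_left
    _ ≤ besselI 1 x ^ W * Real.exp x :=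
        mul_le_mul_of_nonneg_left (tsum_besselI_succ_le_exp hx.le) (pow_nonneg (besselI_pos _ hx).le _)

/-- The ratio sandwich: `(I₁(x)²/I₁(y))^V·I₁(y)/eʸ ≤ S⁺_V(x)²/S⁺_V(y) ≤ (I₁(x)²/I₁(y))^V·(eˣ)²/I₁(x)²`
(`V = W + 1`). [ours] -/
theorem su2Sum_sq_div_mem_Icc (hx : 0 < x) {y : ℝ} (hy : 0 < y) (W : ℕ) :
    (∑' n : ℕ, besselI (n + 1) x ^ (W + 1)) ^ 2 / ∑' n : ℕ, besselI (n + 1) y ^ (W + 1)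
      ∈ Set.Icc ((besselI 1 x ^ 2 / besselI 1 y) ^ (W + 1) * (besselI 1 y / Real.exp y))
          ((besselI 1 x ^ 2 / besselI 1 y) ^ (W + 1) * (Real.exp x ^ 2 / besselI 1 x ^ 2)) := by
  have hV : 1 ≤ W + 1 := by omega
  have hIx := besselI_pos 1 hx
  have hIy := besselI_pos 1 hy
  have h := sq_div_mem_Icc (pow_pos hIx _).le (pow_pos hIy _)
    (besselI_one_pow_le_su2Sum hx hV) (su2Sum_le hx hV)
    (besselI_one_pow_le_su2Sum hy hV) (su2Sum_le hy hV)
  rw [show W + 1 - 1 = W from rfl, geometric_lower_eq hIy.ne' (Real.exp_pos _).ne',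
    geometric_upper_eq hIx.ne' hIy.ne'] at h
  exact h

end SectorSum

/-! ## §2 ESS of the untrained SU(2) torus sampler vs the factorised rate -/

section Torus

variable {L : ℕ} [NeZero L] {β : ℝ}

omit [NeZero L] in
/-- `L² = W + 1` for some `W` when `L ≥ 1`. [folklore] -/
theorem sq_eq_succ_of_neZero [NeZero L] : ∃ W : ℕ, L ^ 2 = W + 1 :=
  Nat.exists_eq_add_of_le' (Nat.one_le_iff_ne_zero.2 (pow_ne_zero 2 (NeZero.ne L)))

/-- **SU(2) TORUS ESS vs THE FACTORISED RATE** (`β > 0`, `V = L²`): with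
`r = (2/β)·I₁(2β)²/I₁(4β)`, `r^V · I₁(4β)e^{−4β} ≤ ESS ≤ r^V · e^{4β}/I₁(2β)²`. [ours] -/
theorem su2TorusIdentityFlow_essFrac_geometric (hβ : 0 < β) :
    (∫ U, Real.exp (-β * wilsonAction (fundamentalRep (Fin 2)) U)
          / ∫ V, Real.exp (-β * wilsonAction (fundamentalRep (Fin 2)) V)
            ∂(Measure.pi fun _ : Edge 2 L => haarProbability (Matrix.specialUnitaryGroup (Fin 2) ℂ))
        ∂(Measure.pi fun _ : Edge 2 L => haarProbability (Matrix.specialUnitaryGroup (Fin 2) ℂ))) ^ 2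
        / ∫ U, (Real.exp (-β * wilsonAction (fundamentalRep (Fin 2)) U)
          / ∫ V, Real.exp (-β * wilsonAction (fundamentalRep (Fin 2)) V)
            ∂(Measure.pi fun _ : Edge 2 L => haarProbability (Matrix.specialUnitaryGroup (Fin 2) ℂ))) ^ 2
          ∂(Measure.pi fun _ : Edge 2 L => haarProbability (Matrix.specialUnitaryGroup (Fin 2) ℂ))
      ∈ Set.Icc ((2 / β * (besselI 1 (2 * β) ^ 2 / besselI 1 (2 * (2 * β)))) ^ (L ^ 2)
            * (besselI 1 (2 * (2 * β)) / Real.exp (2 * (2 * β))))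
          ((2 / β * (besselI 1 (2 * β) ^ 2 / besselI 1 (2 * (2 * β)))) ^ (L ^ 2)
            * (Real.exp (2 * β) ^ 2 / besselI 1 (2 * β) ^ 2)) := by
  rw [su2TorusIdentityFlow_essFrac hβ]
  obtain ⟨W, hW⟩ := sq_eq_succ_of_neZero (L := L)
  have h2 : 0 < 2 * β := by linarith
  have h4 : 0 < 2 * (2 * β) := by linarith
  have hc : 0 ≤ (2 / β) ^ (L ^ 2) := pow_nonneg (div_nonneg zero_le_two hβ.le) _
  obtain ⟨hlo, hhi⟩ := su2Sum_sq_div_mem_Icc h2 h4 W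
  rw [← hW] at hlo hhi
  constructor
  · rw [mul_pow, mul_assoc]
    exact mul_le_mul_of_nonneg_left hlo hc
  · rw [mul_pow, mul_assoc]
    exact mul_le_mul_of_nonneg_left hhi hc

/-! ## §3 The acceptance collapses geometrically -/

/-- **GEOMETRIC COLLAPSE OF THE UNTRAINED SU(2) TORUS SAMPLER'S ACCEPTANCE** (`β > 0`, `V = L²`):
`(8/9)·((2/β)I₁(2β)²/I₁(4β))^V·I₁(4β)e^{−4β} ≤ acc ≤ ((4/β)I₁(β)²/I₁(2β))^V·e^{2β}/I₁(β)²`. [ours] -/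
theorem su2TorusIdentityFlow_meanAccept_geometric (hβ : 0 < β) :
    ∫ U, ∫ U', min (Real.exp (-β * wilsonAction (fundamentalRep (Fin 2)) U)
          / ∫ V, Real.exp (-β * wilsonAction (fundamentalRep (Fin 2)) V)
            ∂(Measure.pi fun _ : Edge 2 L => haarProbability (Matrix.specialUnitaryGroup (Fin 2) ℂ)))
        (Real.exp (-β * wilsonAction (fundamentalRep (Fin 2)) U')
          / ∫ V, Real.exp (-β * wilsonAction (fundamentalRep (Fin 2)) V)
            ∂(Measure.pi fun _ : Edge 2 L => haarProbability (Matrix.specialUnitaryGroup (Fin 2) ℂ)))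
        ∂(Measure.pi fun _ : Edge 2 L => haarProbability (Matrix.specialUnitaryGroup (Fin 2) ℂ))
        ∂(Measure.pi fun _ : Edge 2 L => haarProbability (Matrix.specialUnitaryGroup (Fin 2) ℂ))
      ∈ Set.Icc (8 / 9 * ((2 / β * (besselI 1 (2 * β) ^ 2 / besselI 1 (2 * (2 * β)))) ^ (L ^ 2)
            * (besselI 1 (2 * (2 * β)) / Real.exp (2 * (2 * β)))))
          ((4 / β * (besselI 1 β ^ 2 / besselI 1 (2 * β))) ^ (L ^ 2)
            * (Real.exp β ^ 2 / besselI 1 β ^ 2)) := by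
  obtain ⟨hlo, hhi⟩ := su2TorusIdentityFlow_meanAccept_mem_Icc (L := L) hβ
  obtain ⟨W, hW⟩ := sq_eq_succ_of_neZero (L := L)
  have h2 : 0 < 2 * β := by linarith
  have h4 : 0 < 2 * (2 * β) := by linarith
  have hc2 : 0 ≤ (2 / β) ^ (L ^ 2) := pow_nonneg (div_nonneg zero_le_two hβ.le) _
  have hc4 : 0 ≤ (4 / β) ^ (L ^ 2) := pow_nonneg (div_nonneg (by norm_num) hβ.le) _
  obtain ⟨hE, -⟩ := su2Sum_sq_div_mem_Icc h2 h4 W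
  obtain ⟨-, hB⟩ := su2Sum_sq_div_mem_Icc hβ h2 W
  rw [← hW] at hE hB
  constructor
  · refine le_trans ?_ hlo
    rw [mul_pow, mul_assoc]
    exact mul_le_mul_of_nonneg_left (mul_le_mul_of_nonneg_left hE hc2) (by norm_num)
  · refine le_trans hhi ?_
    rw [mul_pow, mul_assoc]
    exact mul_le_mul_of_nonneg_left hB hc4

end Torus

end Summit.Ventures.LatticeQCDFlow.Theory2

end
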